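/-
Copyright (c) 2026 the pub-hodgecm-mathlib formalisation cell (harness21).  Prover seat hodgecm-mathlib-LA3-p01 (g0), P6 «MOD programme», half A line L3 (ROOF road),
organ **(ν8k)** = ★ (ν8) `exists_specialFibre_hom_reduction` WITH THE IDEAL-KERNEL CONJUNCT (v′) (LA3-plan DEAL 2026-09-02 03:22:30Z (2) «=»); 2026-09-02.
-/
import Literature.AlgebraicGeometry.AbelianSchemes.AbelianSchemeHomReductionSpecialFibre
import Literature.AlgebraicGeometry.AbelianSchemes.IsogenyKernelReduction
import Literature.AlgebraicGeometry.AbelianSchemes.SerreTranslateCoverLeg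
import Literature.AlgebraicGeometry.AbelianSchemes.IdealTorsionSubgroupScheme
import Literature.AlgebraicGeometry.Limits.SeparatedSchematicExt
import HarnessLib

/-!
# REDUCTION OF A HOMOMORPHISM BETWEEN FIBRE TUPLES — THE SPECIAL-FIBRE OUTPUT WITH ITS IDEAL KERNEL
# (`Ker u = 𝒜_x[𝔞]` upstairs ⇒ `Ker ū = 𝒜_{x̄}[𝔞]` downstairs; [SerreTate1968] §1, [BoschLutkebohmertRaynaud1990] §7.3 Prop. 6)

Topic `AlgebraicGeometry/AbelianSchemes`, namespace `Literature.AlgebraicGeometry.AbelianSchemes.AbelianSchemeOver`.  THEOREMS ONLY (no definition, no named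
fact, no instance, no notation).  Cell `hodgecm-mathlib` (D-0151), F0∕P6 «MOD», organ **(ν8k)**: the head of ★ (ν8) `exists_specialFibre_hom_reduction` VERBATIM — the
special fibre `ū : (𝒜_s)_{x̄} → (𝒞_s)_{x̄″}` of the ★ (ν7) turnkey reduction of a homomorphism `u : (𝒜_η)_x → (𝒞_η)_{x″}` with its four transfers (i)–(iv) — PLUS a fifth
transfer (v′): for an `𝒪`-action `act` on `𝒜` and an ideal `𝔞 ∋ N ≠ 0` presented by Serre data `(E′, P, Q)` (so that the layers `𝒜_•[𝔞] = Ker ψ_P` are finite FLAT,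
★ (S-c) `IdealTorsion.flat_ker_hom`), if `u` is finite surjective and `Ker u = 𝒜_x[𝔞]` on ALL `T`-points, then `Ker ū = 𝒜_{x̄}[𝔞]` on ALL `T`-points.

ROAD for (v′) (no descent, no degree count).  §1 STAGE LEMMA `idealKernelLaw_special_of_generic`: over a stage `V′` with a schematically dominant point `a′`, a
morphism `U` with FLAT kernel and `Ker U_{a′} = 𝒜′_{a′}[𝔞]` has `Ker U_{b′} = 𝒜′_{b′}[𝔞]` at every point `b′`: `U` kills the flat layer `Ker ψ_P` and `ψ_P` kills the
flat `Ker U` — two identities of morphisms out of flat proper sources into separated targets, decided at `a′` (★ `pullback_map_injective_of_flat`) — so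
`Ker U = Ker ψ_P` on all `T`-points over `V′` and ★ `idealKernelLaw_baseChangeHom` specialises.  §2 transports the law through the generic and special five-piece
along-stage isomorphisms (equivariant by ★ (ν6) §1 `fibreHom_comp_alongStageIso_hom`).  §3 HEAD: ★ (ν7) turnkey; `Ker U → Spec D′` is flat since every fibre of `U` is an
isogeny (★ `flat_ker_hom`).
Consumer: the D-line `stub_FROB` ROOF road (`stub_ROOFGEO`: the downstairs leg `q̄` of ★ `exists_roofLeg_specialFibre` acquires `Ker q̄ = 𝒜_{x̄}[𝔭_w]`).
§4 (ED. 2) `exists_specialFibre_hom_reduction_ker_ringAction`: the same head with row (ii-ι) — `𝒪`-equivariance `ι_𝒜(a) ≫ u = u ≫ ι_𝒞(a)` transfers to `ū`, stated in the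
`RingAction` currency `((act.baseChange _).baseChange _).i a` of `hker`∕(v′) for two actions `act`, `act″` (consumer: the COVER road `stub_COV0`, clause (f4)).

HONEST LABEL: HC_CM is proved only modulo the cell's 2 remaining named inputs (hLiu418 24832, h413 24833) until rung 0 closes; generic capital on
`--supports stmt-HodgeConjecture-24832`, pays no letter.

## References
* [SerreTate1968] J.-P. Serre, J. Tate, *Good reduction of abelian varieties*, Ann. of Math. 88 (1968), §1 (Lemma 2, Theorem 1).
* [BoschLutkebohmertRaynaud1990] S. Bosch, W. Lütkebohmert, M. Raynaud, *Néron Models* (1990), §1.2 Prop. 8, §2.4 Prop. 4, §7.3 Prop. 6 (p. 180).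
* [MumfordAV1970] D. Mumford, *Abelian Varieties* (1970), §7 Thm. 4 (p. 72), §15 Thm. 1 (p. 143).
* [MumfordFogartyKirwan1994] D. Mumford, J. Fogarty, F. Kirwan, *GIT*, 3rd ed., Ch. 6 §1 Cor. 6.2 (p. 116), Ch. 7 §2 Def. 7.1–7.2 (p. 129).
* [EGAIV2] A. Grothendieck, J. Dieudonné, EGA IV₂ (1965), Prop. 2.8.5; [EGAIV3] (1966), 11.10.5.
-/

set_option autoImplicit false

noncomputable section

set_option backward.isDefEq.respectTransparency false

open CategoryTheory CategoryTheory.Limits AlgebraicGeometry MonoidalCategory CartesianMonoidalCategory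
open scoped MonObj CategoryTheory.Obj NumberField
open Literature.AlgebraicGeometry.Motives
open IsDedekindDomain IsDedekindDomain.HeightOneSpectrum ValuativeRel
open Literature.NumberTheory.EllipticCurves (genericFibre specGenericPoint)
open Literature.NumberTheory.GaloisRepresentations (closureValuationSubring)
open Literature.NumberTheory.DiophantineGeometry
open Literature.AlgebraicGeometry.GroupSchemes.GroupSchemeKernel (ker kerι kerLift kerLift_ι kerι_comp)

namespace Literature.AlgebraicGeometry.AbelianSchemes

namespace AbelianSchemeOver

universe u

section Bookkeeping

/-! ### §0 Bookkeeping: kernel laws on `T`-points through isomorphisms of abelian varieties -/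

variable {k : Type u} [Field k]

/-- Post-composition with an isomorphism of abelian varieties detects the unit: `f ≫ E = 1 ↔ f = 1`. [folklore] -/
private theorem comp_avIso_hom_eq_one_iff {X Y : AbelianVariety k} (E : X ≅ Y) {W : Over (Spec (.of k))} (f : W ⟶ X.X) :
    f ≫ E.hom.hom.hom.hom = 1 ↔ f = 1 := by
  refine ⟨fun h => ?_, fun h => by rw [h, MonObj.one_comp]⟩
  have h1 := congrArg (fun φ => φ ≫ E.inv.hom.hom.hom) h
  simp only [Category.assoc, AbelianVariety.iso_hom_hom_hom_hom_comp_inv, Category.comp_id, MonObj.one_comp] at h1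
  exact h1

/-- **TRANSPORT OF A KERNEL LAW THROUGH A CONJUGATION.**  `E_A : X ≅ P`, `E_C : C ≅ Q` isomorphisms of abelian varieties, `U′ = E_A⁻¹ ≫ u ≫ E_C`, endomorphism
families `F_X`, `F_P` intertwined by `E_A` on `S`; if `Ker u = ⋂_{r ∈ S} Ker F_X(r)` on all `T`-points then `Ker U′ = ⋂_{r ∈ S} Ker F_P(r)` on all `T`-points. [folklore] -/
private theorem comp_eq_one_iff_of_conj_of_kerLaw {X P C Q : AbelianVariety k} (EA : X ≅ P) (EC : C ≅ Q) {uAV : X ⟶ C} {U' : P ⟶ Q}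
    (hU : U' = EA.inv ≫ uAV ≫ EC.hom) {σ : Type*} (S : Set σ) (FX : σ → (X ⟶ X)) (FP : σ → (P ⟶ P))
    (hequiv : ∀ r ∈ S, FX r ≫ EA.hom = EA.hom ≫ FP r)
    (hlaw : ∀ ⦃W : Over (Spec (.of k))⦄ (t : W ⟶ X.X), t ≫ uAV.hom.hom.hom = 1 ↔ ∀ r ∈ S, t ≫ (FX r).hom.hom.hom = 1)
    ⦃W : Over (Spec (.of k))⦄ (t : W ⟶ P.X) : t ≫ U'.hom.hom.hom = 1 ↔ ∀ r ∈ S, t ≫ (FP r).hom.hom.hom = 1 := by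
  subst hU
  have e1 : (EA.inv ≫ uAV ≫ EC.hom).hom.hom.hom = EA.inv.hom.hom.hom ≫ uAV.hom.hom.hom ≫ EC.hom.hom.hom.hom := rfl
  rw [e1, ← Category.assoc, ← Category.assoc, comp_avIso_hom_eq_one_iff EC, hlaw (t ≫ EA.inv.hom.hom.hom)]
  refine forall₂_congr fun r hr => ?_
  have h1 := congrArg (fun φ => (EA.inv ≫ φ ≫ EA.inv).hom.hom.hom) (hequiv r hr)
  simp only [Category.assoc, Iso.hom_inv_id, Category.comp_id, Iso.inv_hom_id_assoc] at h1
  have h2 : EA.inv.hom.hom.hom ≫ (FX r).hom.hom.hom = (FP r).hom.hom.hom ≫ EA.inv.hom.hom.hom := h1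
  rw [Category.assoc, h2, ← Category.assoc]
  exact comp_avIso_hom_eq_one_iff EA.symm (t ≫ (FP r).hom.hom.hom)

/-- The same transport for `U″ = E_A ≫ u ≫ E_C⁻¹` with `E_A : P ≅ X`, `E_C : Q ≅ C` and `F_P(r) ≫ E_A = E_A ≫ F_X(r)`. [folklore] -/
private theorem comp_eq_one_iff_of_conj_of_kerLaw' {X P C Q : AbelianVariety k} (EA : P ≅ X) (EC : Q ≅ C) (uAV : X ⟶ C)
    {σ : Type*} (S : Set σ) (FX : σ → (X ⟶ X)) (FP : σ → (P ⟶ P)) (hequiv : ∀ r ∈ S, FP r ≫ EA.hom = EA.hom ≫ FX r)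
    (hlaw : ∀ ⦃W : Over (Spec (.of k))⦄ (t : W ⟶ X.X), t ≫ uAV.hom.hom.hom = 1 ↔ ∀ r ∈ S, t ≫ (FX r).hom.hom.hom = 1)
    ⦃W : Over (Spec (.of k))⦄ (t : W ⟶ P.X) : t ≫ (EA.hom ≫ uAV ≫ EC.inv).hom.hom.hom = 1 ↔ ∀ r ∈ S, t ≫ (FP r).hom.hom.hom = 1 :=
  comp_eq_one_iff_of_conj_of_kerLaw EA.symm EC.symm (U' := EA.hom ≫ uAV ≫ EC.inv) rfl S FX FP (fun r hr => by
    have h1 := congrArg (fun φ => EA.inv ≫ φ ≫ EA.inv) (hequiv r hr)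
    simp only [Category.assoc, Iso.hom_inv_id, Category.comp_id, Iso.inv_hom_id_assoc] at h1
    exact h1.symm) hlaw t

end Bookkeeping

section Stage

/-! ### §1 The stage lemma: an ideal-kernel law at the schematically dominant point holds at every point -/

variable {V' : Scheme.{u}} {Ω κ : Type u} [Field Ω] [Field κ] (a' : Spec (.of Ω) ⟶ V') (b' : Spec (.of κ) ⟶ V')
  [QuasiCompact a'] [IsSchemeTheoreticallyDominant a']
  {𝒜' 𝒞' : AbelianSchemeOver V'} {O : Type*} [CommRing O] (act' : 𝒜'.RingAction O) [IsCommMonObj 𝒜'.X]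
  {m : ℕ} (E' : Matrix (Fin m) (Fin m) O) (hE' : E' * E' = E') (P : Matrix (Fin m) (Fin 1) O) (Q : Matrix (Fin 1) (Fin m) O) {N : ℕ}
  (U : 𝒜'.X ⟶ 𝒞'.X) [Flat (ker U).hom]

include hE' in
set_option maxHeartbeats 400000 in
/-- **(ν8k) STAGE LEMMA.**  Over a stage `V′` with a schematically dominant quasi-compact point `a′ : Spec Ω → V′`: if an fppf homomorphism `U : 𝒜′ → 𝒞′` with FLAT kernel has
`Ker U_{a′} = 𝒜′_{a′}[𝔞]` on all `T`-points, then `Ker U_{b′} = 𝒜′_{b′}[𝔞]` on all `T`-points at EVERY point `b′` of the stage (`𝔞` presented by Serre data with scalar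
`N ≠ 0`; `U` need not be a homomorphism).  ROAD (no descent): `U` kills the flat layer `𝒜′[𝔞] = Ker ψ_P` and `ψ_P` kills the flat `Ker U` — both identities of
morphisms out of a FLAT proper source into a separated target, decided after base change to the schematically dominant point `a′` (★ `pullback_map_injective_of_flat`);
hence `Ker U = Ker ψ_P` on all `T`-points over `V′` (`kerLift`), and base change to `b′` (★ `idealKernelLaw_baseChangeHom`).
[cite: BoschLutkebohmertRaynaud1990, §7.3 Prop. 6 (p. 180)] [cite: MumfordAV1970, §7 Thm. 4 (p. 72)] [cite: EGAIV2, Prop. 2.8.5] -/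
theorem idealKernelLaw_special_of_generic (hN : N ≠ 0) (hP : E' * P = P) (hQ : Q * E' = Q)
    (hQP : Q * P = Matrix.scalar (Fin 1) (N : O)) (hPQ : P * Q = Matrix.scalar (Fin m) (N : O) * E')
    {𝔞 : Ideal O} (h𝔞 : Ideal.span (Set.range fun k => P k 0) = 𝔞)
    (hgen : ∀ ⦃T : Over (Spec (.of Ω))⦄ (t : T ⟶ (𝒜'.baseChange a').X),
      t ≫ baseChangeHom U a' = 1 ↔ ∀ r ∈ 𝔞, t ≫ (act'.baseChange a').i r = 1)
    ⦃T : Over (Spec (.of κ))⦄ (t : T ⟶ (𝒜'.baseChange b').X) :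
    t ≫ baseChangeHom U b' = 1 ↔ ∀ r ∈ 𝔞, t ≫ (act'.baseChange b').i r = 1 := by
  haveI := isMonHom_serreTranslate act' E' hE' P
  haveI := 𝒞'.isProper
  haveI : IsSeparated 𝒞'.X.hom := inferInstance
  haveI := (serreTensor act' E' hE').isProper
  haveI : IsSeparated (serreTensor act' E' hE').X.hom := inferInstance
  haveI : Flat (ker (serreTranslate act' E' hE' P)).hom := IdealTorsion.flat_ker_hom act' E' hE' P Q hN hP hQ hQP hPQ
  -- the kernel law of `ψ_P` at every point (★ organ #1, from ★ `comp_serreTranslate_eq_one_iff_forall_mem`)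
  have hψ : ∀ {S'' : Scheme.{u}} (s : S'' ⟶ V') ⦃T : Over S''⦄ (t : T ⟶ (𝒜'.baseChange s).X),
      t ≫ baseChangeHom (serreTranslate act' E' hE' P) s = 1 ↔ ∀ r ∈ 𝔞, t ≫ (act'.baseChange s).i r = 1 :=
    fun s T t => idealKernelLaw_baseChangeHom s act' (serreTranslate act' E' hE' P) (𝔞 : Set O)
      (fun _ t₀ => comp_serreTranslate_eq_one_iff_forall_mem act' E' hE' P hP h𝔞 t₀) t
  -- (1) `U` kills `Ker ψ_P = 𝒜′[𝔞]` (decided at the schematically dominant point `a′`)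
  have hkU : kerι (serreTranslate act' E' hE' P) ≫ U = 1 := by
    have key : (Over.pullback a').map (kerι (serreTranslate act' E' hE' P) ≫ U) =
        (Over.pullback a').map (1 : ker (serreTranslate act' E' hE' P) ⟶ 𝒞'.X) := by
      rw [Functor.map_comp, pullback_map_one]
      refine (hgen ((Over.pullback a').map (kerι (serreTranslate act' E' hE' P)))).2 fun r hr => ?_
      rw [RingAction.baseChange_i, ← Functor.map_comp, IdealTorsion.kerι_comp_i_eq_one act' E' hE' P hP h𝔞 hr, pullback_map_one]
    exact Literature.AlgebraicGeometry.Limits.pullback_map_injective_of_flat a' key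
  -- hence `U` kills every `T`-point killed by `ψ_P`
  have hUkill : ∀ ⦃T : Over V'⦄ (t : T ⟶ 𝒜'.X), t ≫ serreTranslate act' E' hE' P = 1 → t ≫ U = 1 := fun T t ht => by
    rw [← kerLift_ι t ht, Category.assoc, hkU, MonObj.comp_one]
  -- (2) `ψ_P` kills `Ker U` (decided at `a′`; `Ker U` is flat by hypothesis)
  have hkψ : kerι U ≫ serreTranslate act' E' hE' P = 1 := by
    have key : (Over.pullback a').map (kerι U ≫ serreTranslate act' E' hE' P) =
        (Over.pullback a').map (1 : ker U ⟶ (serreTensor act' E' hE').X) := by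
      rw [Functor.map_comp, pullback_map_one]
      refine (hψ a' ((Over.pullback a').map (kerι U))).2 fun r hr => ?_
      have h1 : (Over.pullback a').map (kerι U) ≫ baseChangeHom U a' = (1 : _ ⟶ (𝒞'.baseChange a').X) := by
        have h0 := congrArg (fun f => (Over.pullback a').map f) (kerι_comp U)
        simp only [Functor.map_comp] at h0
        rw [pullback_map_one] at h0
        exact h0
      exact ((hgen ((Over.pullback a').map (kerι U))).1 h1) r hr
    exact Literature.AlgebraicGeometry.Limits.pullback_map_injective_of_flat a' key
  have hψkill : ∀ ⦃T : Over V'⦄ (t : T ⟶ 𝒜'.X), t ≫ U = 1 → t ≫ serreTranslate act' E' hE' P = 1 := fun T t ht => by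
    rw [← kerLift_ι t ht, Category.assoc, hkψ, MonObj.comp_one]
  -- (3) the law for `U` over the whole stage, then base change to `b′` (★ `idealKernelLaw_baseChangeHom`)
  have hlaw : ∀ ⦃T : Over V'⦄ (t : T ⟶ 𝒜'.X), t ≫ U = 1 ↔ ∀ r ∈ (𝔞 : Set O), t ≫ act'.i r = 1 := fun T t =>
    ⟨fun h => (comp_serreTranslate_eq_one_iff_forall_mem act' E' hE' P hP h𝔞 t).1 (hψkill t h),
      fun h => hUkill t ((comp_serreTranslate_eq_one_iff_forall_mem act' E' hE' P hP h𝔞 t).2 h)⟩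
  exact idealKernelLaw_baseChangeHom b' act' U (𝔞 : Set O) hlaw t

end Stage

section AbstractKer

/-! ### §2 The abstract two-stage setting of ★ (ν8) §1: the ideal-kernel law transfers from `u` to `ū` -/

variable {T Ug V V' Us : Scheme.{u}} {Ω κ : Type u} [Field Ω] [Field κ]
  (j : Ug ⟶ T) (z z'' : V ⟶ T) (g : V' ⟶ V) (y y'' : Spec (.of Ω) ⟶ Ug) (a : Spec (.of Ω) ⟶ V) (a' : Spec (.of Ω) ⟶ V')
  (hpt : y ≫ j = a ≫ z) (hpt'' : y'' ≫ j = a ≫ z'') (e : a' ≫ g = a)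
  (js : Us ⟶ T) (ys ys'' : Spec (.of κ) ⟶ Us) (b : Spec (.of κ) ⟶ V) (b' : Spec (.of κ) ⟶ V')
  (hspt : ys ≫ js = b ≫ z) (hspt'' : ys'' ≫ js = b ≫ z'') (es : b' ≫ g = b)
  (𝒜 𝒞 : AbelianSchemeOver T)
  (U : ((𝒜.baseChange z).baseChange g).X ⟶ ((𝒞.baseChange z'').baseChange g).X) [IsMonHom U]
  (u : ((𝒜.baseChange j).baseChange y).X ⟶ ((𝒞.baseChange j).baseChange y'').X) [IsMonHom u]
  [QuasiCompact a'] [IsSchemeTheoreticallyDominant a']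
  (hfib : fibreHom U a' =
    (𝒜.fibreBaseChangeIso j y ≪≫ 𝒜.fibreCongrPtIso hpt ≪≫ (𝒜.fibreBaseChangeIso z a).symm ≪≫
        ((𝒜.baseChange z).fibreCongrPtIso e).symm ≪≫ ((𝒜.baseChange z).fibreBaseChangeIso g a').symm).inv ≫ homOfIsMonHom u ≫
      (𝒞.fibreBaseChangeIso j y'' ≪≫ 𝒞.fibreCongrPtIso hpt'' ≪≫ (𝒞.fibreBaseChangeIso z'' a).symm ≪≫
        ((𝒞.baseChange z'').fibreCongrPtIso e).symm ≪≫ ((𝒞.baseChange z'').fibreBaseChangeIso g a').symm).hom)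

include hfib in
set_option maxHeartbeats 400000 in
/-- **THE IDEAL-KERNEL LAW TRANSFERS FROM THE GENERIC TO THE SPECIAL FIBRE.**  Abstract two-stage setting of ★ (ν8) §1 (`U` a stage homomorphism whose `a′`-fibre is
`u` through the generic five-piece isomorphisms, `hfib`), plus an `𝒪`-action `act` on `𝒜`, Serre data `(E′, P, Q)` presenting `𝔞 ∋ N ≠ 0`, and `Ker U` FLAT over the
stage.  If `Ker u = 𝒜_y[𝔞]` on all `T`-points, then `ū := E_𝒜 ≫ U_{b′} ≫ E_𝒞⁻¹` has `Ker ū = 𝒜_{ys}[𝔞]` on all `T`-points: transport to `U_{a′}` (§0, ★ (ν6) §1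
naturality), §1 stage lemma, transport back through the special five-piece isomorphisms.
[cite: BoschLutkebohmertRaynaud1990, §7.3 Prop. 6 (p. 180)] [cite: MumfordFogartyKirwan1994, Ch. 6 §1 Corollary 6.2 (p. 116)] [cite: EGAIV3, 11.10.5] -/
theorem comp_specialFibre_eq_one_iff_of_generic {O : Type*} [CommRing O] (act : 𝒜.RingAction O) [IsCommMonObj 𝒜.X]
    {m : ℕ} (E' : Matrix (Fin m) (Fin m) O) (hE' : E' * E' = E') (P : Matrix (Fin m) (Fin 1) O) (Q : Matrix (Fin 1) (Fin m) O) {N : ℕ}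
    (hN : N ≠ 0) (hP : E' * P = P) (hQ : Q * E' = Q) (hQP : Q * P = Matrix.scalar (Fin 1) (N : O)) (hPQ : P * Q = Matrix.scalar (Fin m) (N : O) * E')
    {𝔞 : Ideal O} (h𝔞 : Ideal.span (Set.range fun k => P k 0) = 𝔞) [Flat (ker U).hom]
    (hker : ∀ ⦃W : Over (Spec (.of Ω))⦄ (t : W ⟶ ((𝒜.baseChange j).baseChange y).X),
      t ≫ u = 1 ↔ ∀ r ∈ 𝔞, t ≫ ((act.baseChange j).baseChange y).i r = 1)
    ⦃W : Over (Spec (.of κ))⦄ (t : W ⟶ ((𝒜.baseChange js).baseChange ys).X) :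
    t ≫ ((𝒜.fibreBaseChangeIso js ys ≪≫ 𝒜.fibreCongrPtIso hspt ≪≫ (𝒜.fibreBaseChangeIso z b).symm ≪≫
              ((𝒜.baseChange z).fibreCongrPtIso es).symm ≪≫ ((𝒜.baseChange z).fibreBaseChangeIso g b').symm).hom ≫
            fibreHom U b' ≫
          (𝒞.fibreBaseChangeIso js ys'' ≪≫ 𝒞.fibreCongrPtIso hspt'' ≪≫ (𝒞.fibreBaseChangeIso z'' b).symm ≪≫
              ((𝒞.baseChange z'').fibreCongrPtIso es).symm ≪≫ ((𝒞.baseChange z'').fibreBaseChangeIso g b').symm).inv).hom.hom.hom = 1 ↔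
      ∀ r ∈ 𝔞, t ≫ ((act.baseChange js).baseChange ys).i r = 1 := by
  haveI : ∀ r, IsMonHom (act.i r) := act.isMonHom
  haveI : ∀ r, IsMonHom (baseChangeHom (act.i r) j) := fun r => (act.baseChange j).isMonHom r
  haveI : ∀ r, IsMonHom (baseChangeHom (baseChangeHom (act.i r) j) y) := fun r => ((act.baseChange j).baseChange y).isMonHom r
  haveI : ∀ r, IsMonHom (baseChangeHom (act.i r) z) := fun r => (act.baseChange z).isMonHom r
  haveI : ∀ r, IsMonHom (baseChangeHom (baseChangeHom (act.i r) z) g) := fun r => ((act.baseChange z).baseChange g).isMonHom r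
  haveI : ∀ r, IsMonHom (baseChangeHom (act.i r) js) := fun r => (act.baseChange js).isMonHom r
  haveI : ∀ r, IsMonHom (baseChangeHom (baseChangeHom (act.i r) js) ys) := fun r => ((act.baseChange js).baseChange ys).isMonHom r
  haveI := isCommMonObj_baseChange z (A := 𝒜)
  haveI := isCommMonObj_baseChange g (A := 𝒜.baseChange z)
  -- Step A: the law for `U_{a′}` — transport of `hker` through the generic five-piece isomorphisms (`hfib`; naturality ★ (ν6) §1)
  have hgen : ∀ ⦃W : Over (Spec (.of Ω))⦄ (t : W ⟶ (((𝒜.baseChange z).baseChange g).baseChange a').X),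
      t ≫ baseChangeHom U a' = 1 ↔ ∀ r ∈ 𝔞, t ≫ (((act.baseChange z).baseChange g).baseChange a').i r = 1 := fun W t =>
    comp_eq_one_iff_of_conj_of_kerLaw _ _ hfib (𝔞 : Set O) (fun r => fibreHom (baseChangeHom (act.i r) j) y)
      (fun r => fibreHom (baseChangeHom (baseChangeHom (act.i r) z) g) a')
      (fun r _ => fibreHom_comp_alongStageIso_hom j z g y a a' hpt e 𝒜 𝒜 (act.i r)) hker t
  -- Step B: the law for `U_{b′}` (§1: flat `Ker U`, flat layer `Ker ψ_P`, both kills decided at `a′`)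
  have hsp : ∀ ⦃W : Over (Spec (.of κ))⦄ (t : W ⟶ (((𝒜.baseChange z).baseChange g).baseChange b').X),
      t ≫ baseChangeHom U b' = 1 ↔ ∀ r ∈ 𝔞, t ≫ (((act.baseChange z).baseChange g).baseChange b').i r = 1 :=
    idealKernelLaw_special_of_generic a' b' ((act.baseChange z).baseChange g) E' hE' P Q U hN hP hQ hQP hPQ h𝔞 hgen
  -- Step C: transport back through the special five-piece isomorphisms (naturality ★ (ν6) §1)
  exact comp_eq_one_iff_of_conj_of_kerLaw' _ _ (fibreHom U b') (𝔞 : Set O) (fun r => fibreHom (baseChangeHom (baseChangeHom (act.i r) z) g) b')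
    (fun r => fibreHom (baseChangeHom (act.i r) js) ys) (fun r _ => fibreHom_comp_alongStageIso_hom js z g ys b b' hspt es 𝒜 𝒜 (act.i r)) hsp t

include hfib in
set_option maxHeartbeats 400000 in
/-- **THE FIVE TRANSFERS AT ONCE** (abstract two-stage setting; the stage `V′` connected, reduced, locally Noetherian).  For `ū := E_𝒜 ≫ U_{b′} ≫ E_𝒞⁻¹` read on group
schemes: `ū` is a homomorphism; (i) `U_{b′}` an isogeny ⇒ `ū` flat and surjective; (ii) ★ (ν8) `baseChangeHom_comp_specialFibre_eq_of_generic`; (iii) ★ (ν8)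
`map_specialFibre_restrictPt_eq_of_generic`; (iv) ★ (ν8) `specialFibre_comp_lam_comp_dualIsogenyOver_eq_of_generic`; (v′) `Ker U` flat ⇒ `comp_specialFibre_eq_one_iff_of_generic`.
(One application for the head, instead of five.) [cite: SerreTate1968, §1] [cite: BoschLutkebohmertRaynaud1990, §7.3 Prop. 6 (p. 180)]
[cite: MumfordFogartyKirwan1994, Ch. 6 §1 Corollary 6.2 (p. 116); Ch. 7 §2 Definition 7.2 (p. 129)] [cite: MumfordAV1970, §15 Thm. 1 (p. 143)] -/
theorem specialFibre_transfers_of_generic [IsLocallyNoetherian V'] [PreconnectedSpace V'] [IsReduced V']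
    {O : Type*} [CommRing O] (act : 𝒜.RingAction O) [IsCommMonObj 𝒜.X]
    {m : ℕ} (E' : Matrix (Fin m) (Fin m) O) (hE' : E' * E' = E') (P : Matrix (Fin m) (Fin 1) O) (Q : Matrix (Fin 1) (Fin m) O) {N : ℕ}
    (hN : N ≠ 0) (hP : E' * P = P) (hQ : Q * E' = Q) (hQP : Q * P = Matrix.scalar (Fin 1) (N : O)) (hPQ : P * Q = Matrix.scalar (Fin m) (N : O) * E')
    {𝔞 : Ideal O} (h𝔞 : Ideal.span (Set.range fun k => P k 0) = 𝔞)
    (hker : ∀ ⦃W : Over (Spec (.of Ω))⦄ (t : W ⟶ ((𝒜.baseChange j).baseChange y).X),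
      t ≫ u = 1 ↔ ∀ r ∈ 𝔞, t ≫ ((act.baseChange j).baseChange y).i r = 1) :
    ∃ (_ : IsMonHom ((𝒜.fibreBaseChangeIso js ys ≪≫ 𝒜.fibreCongrPtIso hspt ≪≫ (𝒜.fibreBaseChangeIso z b).symm ≪≫ ((𝒜.baseChange z).fibreCongrPtIso es).symm ≪≫ ((𝒜.baseChange z).fibreBaseChangeIso g b').symm).hom ≫ fibreHom U b' ≫ (𝒞.fibreBaseChangeIso js ys'' ≪≫ 𝒞.fibreCongrPtIso hspt'' ≪≫ (𝒞.fibreBaseChangeIso z'' b).symm ≪≫ ((𝒞.baseChange z'').fibreCongrPtIso es).symm ≪≫ ((𝒞.baseChange z'').fibreBaseChangeIso g b').symm).inv).hom.hom.hom),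
      -- (i)
      (AbelianVariety.IsIsogeny (fibreHom U b') → Flat (Over.Hom.left ((𝒜.fibreBaseChangeIso js ys ≪≫ 𝒜.fibreCongrPtIso hspt ≪≫ (𝒜.fibreBaseChangeIso z b).symm ≪≫ ((𝒜.baseChange z).fibreCongrPtIso es).symm ≪≫ ((𝒜.baseChange z).fibreBaseChangeIso g b').symm).hom ≫ fibreHom U b' ≫ (𝒞.fibreBaseChangeIso js ys'' ≪≫ 𝒞.fibreCongrPtIso hspt'' ≪≫ (𝒞.fibreBaseChangeIso z'' b).symm ≪≫ ((𝒞.baseChange z'').fibreCongrPtIso es).symm ≪≫ ((𝒞.baseChange z'').fibreBaseChangeIso g b').symm).inv).hom.hom.hom) ∧ Function.Surjective (Over.Hom.left ((𝒜.fibreBaseChangeIso js ys ≪≫ 𝒜.fibreCongrPtIso hspt ≪≫ (𝒜.fibreBaseChangeIso z b).symm ≪≫ ((𝒜.baseChange z).fibreCongrPtIso es).symm ≪≫ ((𝒜.baseChange z).fibreBaseChangeIso g b').symm).hom ≫ fibreHom U b' ≫ (𝒞.fibreBaseChangeIso js ys'' ≪≫ 𝒞.fibreCongrPtIso hspt'' ≪≫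 (𝒞.fibreBaseChangeIso z'' b).symm ≪≫ ((𝒞.baseChange z'').fibreCongrPtIso es).symm ≪≫ ((𝒞.baseChange z'').fibreBaseChangeIso g b').symm).inv).hom.hom.hom).base) ∧
      -- (ii)
      (∀ (f : 𝒜.X ⟶ 𝒜.X) (g' : 𝒞.X ⟶ 𝒞.X) [IsMonHom f] [IsMonHom g'],
        baseChangeHom (baseChangeHom f j) y ≫ u = u ≫ baseChangeHom (baseChangeHom g' j) y'' →
        baseChangeHom (baseChangeHom f js) ys ≫ ((𝒜.fibreBaseChangeIso js ys ≪≫ 𝒜.fibreCongrPtIso hspt ≪≫ (𝒜.fibreBaseChangeIso z b).symm ≪≫ ((𝒜.baseChange z).fibreCongrPtIso es).symm ≪≫ ((𝒜.baseChange z).fibreBaseChangeIso g b').symm).hom ≫ fibreHom U b' ≫ (𝒞.fibreBaseChangeIso js ys'' ≪≫ 𝒞.fibreCongrPtIso hspt'' ≪≫ (𝒞.fibreBaseChangeIso z'' b).symm ≪≫ ((𝒞.baseChange z'').fibreCongrPtIso es).symm ≪≫ ((𝒞.baseChange z'').fibreBaseChangeIso g b').symm).inv).hom.hom.hom = ((𝒜.fibreBaseChangeIso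 js ys ≪≫ 𝒜.fibreCongrPtIso hspt ≪≫ (𝒜.fibreBaseChangeIso z b).symm ≪≫ ((𝒜.baseChange z).fibreCongrPtIso es).symm ≪≫ ((𝒜.baseChange z).fibreBaseChangeIso g b').symm).hom ≫ fibreHom U b' ≫ (𝒞.fibreBaseChangeIso js ys'' ≪≫ 𝒞.fibreCongrPtIso hspt'' ≪≫ (𝒞.fibreBaseChangeIso z'' b).symm ≪≫ ((𝒞.baseChange z'').fibreCongrPtIso es).symm ≪≫ ((𝒞.baseChange z'').fibreBaseChangeIso g b').symm).inv).hom.hom.hom ≫ baseChangeHom (baseChangeHom g' js) ys'') ∧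
      -- (iii)
      (∀ (τ : 𝒜.Sections) (τ'' : 𝒞.Sections),
        AlgPoints.map u ((𝒜.baseChange j).restrictPt y (𝒜.sectionBaseChange j τ)) = (𝒞.baseChange j).restrictPt y'' (𝒞.sectionBaseChange j τ'') →
        AlgPoints.map ((𝒜.fibreBaseChangeIso js ys ≪≫ 𝒜.fibreCongrPtIso hspt ≪≫ (𝒜.fibreBaseChangeIso z b).symm ≪≫ ((𝒜.baseChange z).fibreCongrPtIso es).symm ≪≫ ((𝒜.baseChange z).fibreBaseChangeIso g b').symm).hom ≫ fibreHom U b' ≫ (𝒞.fibreBaseChangeIso js ys'' ≪≫ 𝒞.fibreCongrPtIso hspt'' ≪≫ (𝒞.fibreBaseChangeIso z'' b).symm ≪≫ ((𝒞.baseChange z'').fibreCongrPtIso es).symm ≪≫ ((𝒞.baseChange z'').fibreBaseChangeIso g b').symm).inv).hom.hom.hom ((𝒜.baseChange js).restrictPt ys (𝒜.sectionBaseChange js τ)) = (𝒞.baseChange js).restrictPt ys'' (𝒞.sectionBaseChange js τ'')) ∧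
      -- (iv)
      (∀ (D𝒜 : 𝒜.DualPair) (pol𝒜 : 𝒜.Polarization D𝒜) (D𝒞 : 𝒞.DualPair) (pol𝒞 : 𝒞.Polarization D𝒞) (n : ℕ),
        u ≫ ((pol𝒞.baseChange j).baseChange y'').lam ≫ DualPair.dualIsogenyOver u ((D𝒜.baseChange j).baseChange y) ((D𝒞.baseChange j).baseChange y'') =
          ((pol𝒜.baseChange j).baseChange y).lam ≫ ((D𝒜.baseChange j).baseChange y).hat.mulN n →
        ((𝒜.fibreBaseChangeIso js ys ≪≫ 𝒜.fibreCongrPtIso hspt ≪≫ (𝒜.fibreBaseChangeIso z b).symm ≪≫ ((𝒜.baseChange z).fibreCongrPtIso es).symm ≪≫ ((𝒜.baseChange z).fibreBaseChangeIso g b').symm).hom ≫ fibreHom U b' ≫ (𝒞.fibreBaseChangeIso js ys'' ≪≫ 𝒞.fibreCongrPtIso hspt'' ≪≫ (𝒞.fibreBaseChangeIso z'' b).symm ≪≫ ((𝒞.baseChange z'').fibreCongrPtIso es).symm ≪≫ ((𝒞.baseChange z'').fibreBaseChangeIso g b').symm).inv).hom.hom.hom ≫ ((pol𝒞.baseChange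 js).baseChange ys'').lam ≫
            @DualPair.dualIsogenyOver _ ((𝒜.baseChange js).baseChange ys) ((𝒞.baseChange js).baseChange ys'') ((𝒜.fibreBaseChangeIso js ys ≪≫ 𝒜.fibreCongrPtIso hspt ≪≫ (𝒜.fibreBaseChangeIso z b).symm ≪≫ ((𝒜.baseChange z).fibreCongrPtIso es).symm ≪≫ ((𝒜.baseChange z).fibreBaseChangeIso g b').symm).hom ≫ fibreHom U b' ≫ (𝒞.fibreBaseChangeIso js ys'' ≪≫ 𝒞.fibreCongrPtIso hspt'' ≪≫ (𝒞.fibreBaseChangeIso z'' b).symm ≪≫ ((𝒞.baseChange z'').fibreCongrPtIso es).symm ≪≫ ((𝒞.baseChange z'').fibreBaseChangeIso g b').symm).inv).hom.hom.hom ((𝒜.fibreBaseChangeIso js ys ≪≫ 𝒜.fibreCongrPtIso hspt ≪≫ (𝒜.fibreBaseChangeIso z b).symm ≪≫ ((𝒜.baseChange z).fibreCongrPtIso es).symm ≪≫ ((𝒜.baseChange z).fibreBaseChangeIso g b').symm).hom ≫ fibreHom U b' ≫ (𝒞.fibreBaseChangeIso js ys'' ≪≫ 𝒞.fibreCongrPtIso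 hspt'' ≪≫ (𝒞.fibreBaseChangeIso z'' b).symm ≪≫ ((𝒞.baseChange z'').fibreCongrPtIso es).symm ≪≫ ((𝒞.baseChange z'').fibreBaseChangeIso g b').symm).inv).hom.hom.isMonHom_hom
              ((D𝒜.baseChange js).baseChange ys) ((D𝒞.baseChange js).baseChange ys'') =
          ((pol𝒜.baseChange js).baseChange ys).lam ≫ ((D𝒜.baseChange js).baseChange ys).hat.mulN n) ∧
      -- (v′)
      (Flat (ker U).hom → ∀ ⦃W : Over (Spec (.of κ))⦄ (t : W ⟶ ((𝒜.baseChange js).baseChange ys).X),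
        t ≫ ((𝒜.fibreBaseChangeIso js ys ≪≫ 𝒜.fibreCongrPtIso hspt ≪≫ (𝒜.fibreBaseChangeIso z b).symm ≪≫ ((𝒜.baseChange z).fibreCongrPtIso es).symm ≪≫ ((𝒜.baseChange z).fibreBaseChangeIso g b').symm).hom ≫ fibreHom U b' ≫ (𝒞.fibreBaseChangeIso js ys'' ≪≫ 𝒞.fibreCongrPtIso hspt'' ≪≫ (𝒞.fibreBaseChangeIso z'' b).symm ≪≫ ((𝒞.baseChange z'').fibreCongrPtIso es).symm ≪≫ ((𝒞.baseChange z'').fibreBaseChangeIso g b').symm).inv).hom.hom.hom = 1 ↔ ∀ r ∈ 𝔞, t ≫ ((act.baseChange js).baseChange ys).i r = 1) := by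
  refine ⟨((𝒜.fibreBaseChangeIso js ys ≪≫ 𝒜.fibreCongrPtIso hspt ≪≫ (𝒜.fibreBaseChangeIso z b).symm ≪≫ ((𝒜.baseChange z).fibreCongrPtIso es).symm ≪≫ ((𝒜.baseChange z).fibreBaseChangeIso g b').symm).hom ≫ fibreHom U b' ≫ (𝒞.fibreBaseChangeIso js ys'' ≪≫ 𝒞.fibreCongrPtIso hspt'' ≪≫ (𝒞.fibreBaseChangeIso z'' b).symm ≪≫ ((𝒞.baseChange z'').fibreCongrPtIso es).symm ≪≫ ((𝒞.baseChange z'').fibreBaseChangeIso g b').symm).inv).hom.hom.isMonHom_hom, fun hUb => ?_,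
    fun f g' _ _ hfg => baseChangeHom_comp_specialFibre_eq_of_generic j z z'' g y y'' a a' hpt hpt'' e js ys ys'' b b' hspt hspt'' es 𝒜 𝒞 U u hfib f g' hfg,
    fun τ τ'' hτ => map_specialFibre_restrictPt_eq_of_generic j z z'' g y y'' a a' hpt hpt'' e js ys ys'' b b' hspt hspt'' es 𝒜 𝒞 U u hfib τ τ'' hτ,
    fun D𝒜 pol𝒜 D𝒞 pol𝒞 n hlam => specialFibre_comp_lam_comp_dualIsogenyOver_eq_of_generic j z z'' g y y'' a a' hpt hpt'' e js ys ys'' b b' hspt hspt'' es 𝒜 𝒞 U u hfib D𝒜 pol𝒜 D𝒞 pol𝒞 n hlam,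
    fun hflat W t => ?_⟩
  · -- (i) ★ `isIsogeny_hom_comp_iso`, ★ `IsIsogeny.flat`
    have hub : AbelianVariety.IsIsogeny ((𝒜.fibreBaseChangeIso js ys ≪≫ 𝒜.fibreCongrPtIso hspt ≪≫ (𝒜.fibreBaseChangeIso z b).symm ≪≫ ((𝒜.baseChange z).fibreCongrPtIso es).symm ≪≫ ((𝒜.baseChange z).fibreBaseChangeIso g b').symm).hom ≫ fibreHom U b' ≫ (𝒞.fibreBaseChangeIso js ys'' ≪≫ 𝒞.fibreCongrPtIso hspt'' ≪≫ (𝒞.fibreBaseChangeIso z'' b).symm ≪≫ ((𝒞.baseChange z'').fibreCongrPtIso es).symm ≪≫ ((𝒞.baseChange z'').fibreBaseChangeIso g b').symm).inv) := isIsogeny_hom_comp_iso _ (fibreHom U b') (𝒞.fibreBaseChangeIso js ys'' ≪≫ 𝒞.fibreCongrPtIso hspt'' ≪≫ (𝒞.fibreBaseChangeIso z'' b).symm ≪≫ ((𝒞.baseChange z'').fibreCongrPtIso es).symm ≪≫ ((𝒞.baseChange z'').fibreBaseChangeIso g b').symm).symm hUb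
    exact ⟨hub.flat, hub.1.surj⟩
  · -- (v′) §2
    haveI := hflat
    exact comp_specialFibre_eq_one_iff_of_generic j z z'' g y y'' a a' hpt hpt'' e js ys ys'' b b' hspt hspt'' es 𝒜 𝒞 U u hfib act E' hE' P Q hN hP hQ hQP hPQ h𝔞 hker t

end AbstractKer

section HeadK

/-! ### §3 The head: ★ (ν8) verbatim, with the fifth transfer (v′) -/

variable {K : Type} [Field K] [NumberField K] {v : HeightOneSpectrum (𝓞 K)} {Y : SchemeOver K}
  (𝓨 : IntegralModel (valuationSubringAtPrime K v) K Y) [IsProper 𝓨.total.hom]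
  (𝒜 𝒞 : AbelianSchemeOver 𝓨.total.left) (x x'' : AlgPoints Y (AlgebraicClosure (v.adicCompletion K)))

set_option maxHeartbeats 400000 in
/-- **THE SPECIAL FIBRE OF THE REDUCTION OF A HOMOMORPHISM BETWEEN FIBRE TUPLES, WITH ITS FOUR TRANSFERS AND ITS IDEAL KERNEL.**  ★ (ν8)
`exists_specialFibre_hom_reduction` verbatim — `𝓨` a proper model at `v`, `𝒜, 𝒞 → 𝓨` abelian schemes, `x, x″ ∈ Y(Ω)`, `u : (𝒜_η)_x → (𝒞_η)_{x″}` a homomorphism;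
output `ū : (𝒜_s)_{x̄} → (𝒞_s)_{x̄″}` with (i) finite surjective ⇒ flat surjective, (ii) equivariance, (iii) section values, (iv) polarisation laws — PLUS, for an
`𝒪`-action `act` on `𝒜` and an ideal `𝔞` presented by Serre data `(E′, P, Q)` with scalar `N ≠ 0` (`hP hQ hQP hPQ h𝔞`): (v′) if `u` is finite surjective and
`Ker u = 𝒜_x[𝔞]` on all `T`-points (`hker`, `𝒜_x[𝔞] := ⋂_{a ∈ 𝔞} Ker ι(a)`), then `Ker ū = 𝒜_{x̄}[𝔞]` on all `T`-points.  ((v′): `Ker U` of the ★ (ν7) stage homomorphism is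
flat — every fibre of `U` is an isogeny, ★ `flat_ker_hom` — and §2.) [cite: SerreTate1968, §1] [cite: BoschLutkebohmertRaynaud1990, §1.2 Prop. 8 and §7.3 Prop. 6 (p. 180)]
[cite: MumfordFogartyKirwan1994, Ch. 6 §1 Corollary 6.2 (p. 116); Ch. 7 §2 Definition 7.2 (p. 129)] [cite: MumfordAV1970, §7 Thm. 4 (p. 72), §15 Thm. 1 (p. 143)] -/
theorem exists_specialFibre_hom_reduction_ker
    (u : ((𝒜.baseChange (𝓨.genericIso'.inv.left ≫ pullback.fst 𝓨.total.hom (specGenericPoint (valuationSubringAtPrime K v) K))).baseChange x.left).X ⟶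
         ((𝒞.baseChange (𝓨.genericIso'.inv.left ≫ pullback.fst 𝓨.total.hom (specGenericPoint (valuationSubringAtPrime K v) K))).baseChange x''.left).X)
    [IsMonHom u]
    -- (ν8k) extra data: an `𝒪`-action on `𝒜` and a Serre presentation of the ideal `𝔞` (★ (S-c) layers are finite flat)
    {O : Type} [CommRing O] (act : 𝒜.RingAction O) [IsCommMonObj 𝒜.X]
    {m : ℕ} (E' : Matrix (Fin m) (Fin m) O) (hE' : E' * E' = E') (P : Matrix (Fin m) (Fin 1) O) (Q : Matrix (Fin 1) (Fin m) O) {N : ℕ}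
    (hN : N ≠ 0) (hP : E' * P = P) (hQ : Q * E' = Q) (hQP : Q * P = Matrix.scalar (Fin 1) (N : O)) (hPQ : P * Q = Matrix.scalar (Fin m) (N : O) * E')
    {𝔞 : Ideal O} (h𝔞 : Ideal.span (Set.range fun k => P k 0) = 𝔞)
    -- (v′) hypothesis: `Ker u = 𝒜_x[𝔞]` on ALL `T`-points
    (hker : ∀ ⦃T : Over (Spec (.of (AlgebraicClosure (v.adicCompletion K))))⦄ (t : T ⟶ ((𝒜.baseChange (𝓨.genericIso'.inv.left ≫ pullback.fst 𝓨.total.hom (specGenericPoint (valuationSubringAtPrime K v) K))).baseChange x.left).X),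
      t ≫ u = 1 ↔ ∀ a ∈ 𝔞, t ≫ ((act.baseChange (𝓨.genericIso'.inv.left ≫ pullback.fst 𝓨.total.hom (specGenericPoint (valuationSubringAtPrime K v) K))).baseChange x.left).i a = 1) :
    ∃ (ubar : ((𝒜.baseChange (pullback.fst 𝓨.total.hom (specResidueField v))).baseChange (𝓨.geomReductionMap x).left).X ⟶
               ((𝒞.baseChange (pullback.fst 𝓨.total.hom (specResidueField v))).baseChange (𝓨.geomReductionMap x'').left).X) (_ : IsMonHom ubar),
      -- (i) finite surjective ⇒ flat surjective
      (IsFinite u.left → Surjective u.left → Flat ubar.left ∧ Function.Surjective ubar.left.base) ∧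
      -- (ii) equivariance for endomorphism pairs transfers
      (∀ (f : 𝒜.X ⟶ 𝒜.X) (g : 𝒞.X ⟶ 𝒞.X) [IsMonHom f] [IsMonHom g],
        baseChangeHom (baseChangeHom f _) x.left ≫ u = u ≫ baseChangeHom (baseChangeHom g _) x''.left →
        baseChangeHom (baseChangeHom f (pullback.fst 𝓨.total.hom (specResidueField v))) (𝓨.geomReductionMap x).left ≫ ubar =
          ubar ≫ baseChangeHom (baseChangeHom g (pullback.fst 𝓨.total.hom (specResidueField v))) (𝓨.geomReductionMap x'').left) ∧
      -- (iii) identities of section values transfer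
      (∀ (τ : 𝒜.Sections) (τ'' : 𝒞.Sections),
        AlgPoints.map u ((𝒜.baseChange _).restrictPt x.left (𝒜.sectionBaseChange _ τ)) =
          (𝒞.baseChange _).restrictPt x''.left (𝒞.sectionBaseChange _ τ'') →
        AlgPoints.map ubar ((𝒜.baseChange (pullback.fst 𝓨.total.hom (specResidueField v))).restrictPt (𝓨.geomReductionMap x).left
            (𝒜.sectionBaseChange _ τ)) =
          (𝒞.baseChange (pullback.fst 𝓨.total.hom (specResidueField v))).restrictPt (𝓨.geomReductionMap x'').left (𝒞.sectionBaseChange _ τ'')) ∧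
      -- (iv) a polarisation law in dual-homomorphism form transfers
      (∀ (D𝒜 : 𝒜.DualPair) (pol𝒜 : 𝒜.Polarization D𝒜) (D𝒞 : 𝒞.DualPair) (pol𝒞 : 𝒞.Polarization D𝒞) (n : ℕ),
        u ≫ ((pol𝒞.baseChange _).baseChange x''.left).lam ≫ DualPair.dualIsogenyOver u ((D𝒜.baseChange _).baseChange x.left) ((D𝒞.baseChange _).baseChange x''.left) =
          ((pol𝒜.baseChange _).baseChange x.left).lam ≫ ((D𝒜.baseChange _).baseChange x.left).hat.mulN n →
        ubar ≫ ((pol𝒞.baseChange (pullback.fst 𝓨.total.hom (specResidueField v))).baseChange (𝓨.geomReductionMap x'').left).lam ≫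
            DualPair.dualIsogenyOver ubar ((D𝒜.baseChange (pullback.fst 𝓨.total.hom (specResidueField v))).baseChange (𝓨.geomReductionMap x).left)
              ((D𝒞.baseChange (pullback.fst 𝓨.total.hom (specResidueField v))).baseChange (𝓨.geomReductionMap x'').left) =
          ((pol𝒜.baseChange (pullback.fst 𝓨.total.hom (specResidueField v))).baseChange (𝓨.geomReductionMap x).left).lam ≫
            ((D𝒜.baseChange (pullback.fst 𝓨.total.hom (specResidueField v))).baseChange (𝓨.geomReductionMap x).left).hat.mulN n) ∧
      -- (v′) `u` finite surjective with `Ker u = 𝒜_x[𝔞]` on all `T`-points ⇒ `Ker ū = 𝒜_{x̄}[𝔞]` on ALL `T`-points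
      (IsFinite u.left → Surjective u.left → ∀ ⦃T : Over (Spec (.of (geomResidueField v)))⦄ (t : T ⟶ ((𝒜.baseChange (pullback.fst 𝓨.total.hom (specResidueField v))).baseChange (𝓨.geomReductionMap x).left).X),
        t ≫ ubar = 1 ↔ ∀ a ∈ 𝔞, t ≫ ((act.baseChange (pullback.fst 𝓨.total.hom (specResidueField v))).baseChange (𝓨.geomReductionMap x).left).i a = 1) := by
  -- the homomorphism of abelian varieties underlying `u`, and the TURNKEY reduction ★ (ν7)
  obtain ⟨D, _i1, _i2, L, _i3, _i4, _i5, _i6, _i7, _i8, gD, h, hh, hgD, ha, z, z'', hz, hz'', L', _j1, _j2, _j3, _j4, _j5, χ, h', U, hU,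
      hpt, hpt'', e, hspt, hspt'', et, hχ, hh', hh'h, hDed, hFrac, hfib, huniq, hisog⟩ :=
    exists_stage_hom_reduction_turnkey 𝓨 𝒜 𝒞 x x'' (homOfIsMonHom u)
  haveI := hDed
  haveI := hFrac
  haveI := hU
  -- injectivity of restriction to the `Ω`-point `ξ′` of the refined stage (schematically dominant: `D′ → Ω` injective)
  have h'inj : Function.Injective h' := by
    intro a b hab
    have h1 : χ (a : L') = χ (b : L') := by rw [← hh', ← hh', hab]
    exact Subtype.ext (hχ h1)
  haveI : IsDominant (specGenericPoint (closureValuationSubring (v.adicCompletion K)) (AlgebraicClosure (v.adicCompletion K)) ≫ Spec.map (CommRingCat.ofHom h')) := by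
    haveI := isDominant_specMap_of_injective
      (algebraMap (closureValuationSubring (v.adicCompletion K)) (AlgebraicClosure (v.adicCompletion K))) Subtype.val_injective
    haveI := isDominant_specMap_of_injective h' h'inj
    infer_instance
  haveI : IsSchemeTheoreticallyDominant (specGenericPoint (closureValuationSubring (v.adicCompletion K)) (AlgebraicClosure (v.adicCompletion K)) ≫ Spec.map (CommRingCat.ofHom h')) := IsSchemeTheoreticallyDominant.of_isDominant _
  -- the refined stage `Spec D′` is connected, reduced, Noetherian (Dedekind)
  haveI : IsNoetherianRing (integralClosure D L') := inferInstance
  -- ALL FIVE TRANSFERS AT ONCE (§2 `specialFibre_transfers_of_generic` at the turnkey's two stages; `ū := E_𝒜 ≫ U_{t′} ≫ E_𝒞⁻¹` through the special five-piece isomorphisms)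
  have H := specialFibre_transfers_of_generic (𝓨.genericIso'.inv.left ≫ pullback.fst 𝓨.total.hom (specGenericPoint (valuationSubringAtPrime K v) K)) z.left z''.left (Spec.map (CommRingCat.ofHom (algebraMap D (integralClosure D L')))) x.left x''.left (specGenericPoint (closureValuationSubring (v.adicCompletion K)) (AlgebraicClosure (v.adicCompletion K)) ≫ Spec.map (CommRingCat.ofHom h)) (specGenericPoint (closureValuationSubring (v.adicCompletion K)) (AlgebraicClosure (v.adicCompletion K)) ≫ Spec.map (CommRingCat.ofHom h')) hpt hpt'' e
    (pullback.fst 𝓨.total.hom (specResidueField v)) (𝓨.geomReductionMap x).left (𝓨.geomReductionMap x'').left (((geomClosedPointIsoSpecResidueField v).inv.left ≫ (specRingHomι (closureValuationSubring (v.adicCompletion K)) (toClosureValuationSubring v) (IsLocalRing.residue (closureValuationSubring (v.adicCompletion K)))).left) ≫ Spec.map (CommRingCat.ofHom h)) (((geomClosedPointIsoSpecResidueField v).inv.left ≫ (specRingHomι (closureValuationSubring (v.adicCompletion K)) (toClosureValuationSubring v) (IsLocalRing.residue (closureValuationSubring (v.adicCompletion K)))).left) ≫ Spec.map (CommRingCat.ofHom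 h')) hspt hspt'' et 𝒜 𝒞 U u hfib act E' hE' P Q hN hP hQ hQP hPQ h𝔞 hker
  -- (i) and (v′): `u` an isogeny ⇒ every fibre of `U` over `Spec D′` is (★ (ν7)), in particular `U_{t′}`; and `Ker U → Spec D′` is flat (★ `flat_ker_hom` at the generic point)
  exact ⟨_, H.fst, fun hfin hsurj => H.snd.1 (hisog ⟨hsurj, hfin⟩ _), H.snd.2.1, H.snd.2.2.1, H.snd.2.2.2.1,
    fun hfin hsurj => H.snd.2.2.2.2 (flat_ker_hom L' U (hisog ⟨hsurj, hfin⟩ (specGenericPoint (integralClosure D L') L')))⟩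

end HeadK

section HeadKAction

/-! ### §4 (ED. 2) The head with the equivariance transfer in `RingAction` currency: row (ii-ι) for two `𝒪`-actions -/

variable {K : Type} [Field K] [NumberField K] {v : HeightOneSpectrum (𝓞 K)} {Y : SchemeOver K}
  (𝓨 : IntegralModel (valuationSubringAtPrime K v) K Y) [IsProper 𝓨.total.hom]
  (𝒜 𝒞 : AbelianSchemeOver 𝓨.total.left) (x x'' : AlgPoints Y (AlgebraicClosure (v.adicCompletion K)))

set_option maxHeartbeats 400000 in
/-- **(ν8k), ED. 2 — THE SAME HEAD WITH ROW (ii-ι): `𝒪`-EQUIVARIANCE TRANSFERS, STATED IN THE `RingAction` CURRENCY.**  `exists_specialFibre_hom_reduction_ker`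
verbatim (binders: the head's, with a second action `act″ : 𝒞.RingAction 𝒪` on the TARGET inserted right after `act`; outputs (i), (ii), (iii), (iv), (v′) unchanged),
PLUS, placed right after (ii), the row **(ii-ι)**: for every `a : 𝒪`, if `ι_𝒜(a)_x ≫ u = u ≫ ι_𝒞(a)_{x″}` — spelled `((act.baseChange _).baseChange x.left).i a` ∕
`((act″.baseChange _).baseChange x″.left).i a`, the currency of `hker` and of (v′) — then `ι_𝒜(a)_{x̄} ≫ ū = ū ≫ ι_𝒞(a)_{x̄″}` in the same currency downstairs.  It IS row (ii)
at the pair `(act.i a, act″.i a)` (`(act.baseChange g).i a = (ι a)_g` is ★ `RingAction.baseChange_i`, `rfl`), instantiated HERE where the spelling is native, so that a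
consumer reading `u`, `ū` through fibre abbreviations pays no higher-order unification at the seam (take `act″ := act` when `𝒞 = 𝒜`).
[cite: SerreTate1968, §1] [cite: BoschLutkebohmertRaynaud1990, §1.2 Prop. 8 and §7.3 Prop. 6 (p. 180)] [cite: Kottwitz1992, §5 (p. 390)]
[cite: MumfordFogartyKirwan1994, Ch. 6 §1 Corollary 6.2 (p. 116); Ch. 7 §2 Definition 7.2 (p. 129)] [cite: MumfordAV1970, §7 Thm. 4 (p. 72), §15 Thm. 1 (p. 143)] -/
theorem exists_specialFibre_hom_reduction_ker_ringAction
    (u : ((𝒜.baseChange (𝓨.genericIso'.inv.left ≫ pullback.fst 𝓨.total.hom (specGenericPoint (valuationSubringAtPrime K v) K))).baseChange x.left).X ⟶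
         ((𝒞.baseChange (𝓨.genericIso'.inv.left ≫ pullback.fst 𝓨.total.hom (specGenericPoint (valuationSubringAtPrime K v) K))).baseChange x''.left).X)
    [IsMonHom u]
    {O : Type} [CommRing O] (act : 𝒜.RingAction O) (act'' : 𝒞.RingAction O) [IsCommMonObj 𝒜.X]
    {m : ℕ} (E' : Matrix (Fin m) (Fin m) O) (hE' : E' * E' = E') (P : Matrix (Fin m) (Fin 1) O) (Q : Matrix (Fin 1) (Fin m) O) {N : ℕ}
    (hN : N ≠ 0) (hP : E' * P = P) (hQ : Q * E' = Q) (hQP : Q * P = Matrix.scalar (Fin 1) (N : O)) (hPQ : P * Q = Matrix.scalar (Fin m) (N : O) * E')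
    {𝔞 : Ideal O} (h𝔞 : Ideal.span (Set.range fun k => P k 0) = 𝔞)
    (hker : ∀ ⦃T : Over (Spec (.of (AlgebraicClosure (v.adicCompletion K))))⦄ (t : T ⟶ ((𝒜.baseChange (𝓨.genericIso'.inv.left ≫ pullback.fst 𝓨.total.hom (specGenericPoint (valuationSubringAtPrime K v) K))).baseChange x.left).X),
      t ≫ u = 1 ↔ ∀ a ∈ 𝔞, t ≫ ((act.baseChange (𝓨.genericIso'.inv.left ≫ pullback.fst 𝓨.total.hom (specGenericPoint (valuationSubringAtPrime K v) K))).baseChange x.left).i a = 1) :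
    ∃ (ubar : ((𝒜.baseChange (pullback.fst 𝓨.total.hom (specResidueField v))).baseChange (𝓨.geomReductionMap x).left).X ⟶
               ((𝒞.baseChange (pullback.fst 𝓨.total.hom (specResidueField v))).baseChange (𝓨.geomReductionMap x'').left).X) (_ : IsMonHom ubar),
      -- (i) finite surjective ⇒ flat surjective
      (IsFinite u.left → Surjective u.left → Flat ubar.left ∧ Function.Surjective ubar.left.base) ∧
      -- (ii) equivariance for endomorphism pairs transfers
      (∀ (f : 𝒜.X ⟶ 𝒜.X) (g : 𝒞.X ⟶ 𝒞.X) [IsMonHom f] [IsMonHom g],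
        baseChangeHom (baseChangeHom f _) x.left ≫ u = u ≫ baseChangeHom (baseChangeHom g _) x''.left →
        baseChangeHom (baseChangeHom f (pullback.fst 𝓨.total.hom (specResidueField v))) (𝓨.geomReductionMap x).left ≫ ubar =
          ubar ≫ baseChangeHom (baseChangeHom g (pullback.fst 𝓨.total.hom (specResidueField v))) (𝓨.geomReductionMap x'').left) ∧
      -- (ii-ι) `𝒪`-equivariance transfers, `RingAction` currency (ED. 2)
      (∀ a : O,
        ((act.baseChange (𝓨.genericIso'.inv.left ≫ pullback.fst 𝓨.total.hom (specGenericPoint (valuationSubringAtPrime K v) K))).baseChange x.left).i a ≫ u =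
          u ≫ ((act''.baseChange (𝓨.genericIso'.inv.left ≫ pullback.fst 𝓨.total.hom (specGenericPoint (valuationSubringAtPrime K v) K))).baseChange x''.left).i a →
        ((act.baseChange (pullback.fst 𝓨.total.hom (specResidueField v))).baseChange (𝓨.geomReductionMap x).left).i a ≫ ubar =
          ubar ≫ ((act''.baseChange (pullback.fst 𝓨.total.hom (specResidueField v))).baseChange (𝓨.geomReductionMap x'').left).i a) ∧
      -- (iii) identities of section values transfer
      (∀ (τ : 𝒜.Sections) (τ'' : 𝒞.Sections),
        AlgPoints.map u ((𝒜.baseChange _).restrictPt x.left (𝒜.sectionBaseChange _ τ)) =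
          (𝒞.baseChange _).restrictPt x''.left (𝒞.sectionBaseChange _ τ'') →
        AlgPoints.map ubar ((𝒜.baseChange (pullback.fst 𝓨.total.hom (specResidueField v))).restrictPt (𝓨.geomReductionMap x).left
            (𝒜.sectionBaseChange _ τ)) =
          (𝒞.baseChange (pullback.fst 𝓨.total.hom (specResidueField v))).restrictPt (𝓨.geomReductionMap x'').left (𝒞.sectionBaseChange _ τ'')) ∧
      -- (iv) a polarisation law in dual-homomorphism form transfers
      (∀ (D𝒜 : 𝒜.DualPair) (pol𝒜 : 𝒜.Polarization D𝒜) (D𝒞 : 𝒞.DualPair) (pol𝒞 : 𝒞.Polarization D𝒞) (n : ℕ),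
        u ≫ ((pol𝒞.baseChange _).baseChange x''.left).lam ≫ DualPair.dualIsogenyOver u ((D𝒜.baseChange _).baseChange x.left) ((D𝒞.baseChange _).baseChange x''.left) =
          ((pol𝒜.baseChange _).baseChange x.left).lam ≫ ((D𝒜.baseChange _).baseChange x.left).hat.mulN n →
        ubar ≫ ((pol𝒞.baseChange (pullback.fst 𝓨.total.hom (specResidueField v))).baseChange (𝓨.geomReductionMap x'').left).lam ≫
            DualPair.dualIsogenyOver ubar ((D𝒜.baseChange (pullback.fst 𝓨.total.hom (specResidueField v))).baseChange (𝓨.geomReductionMap x).left)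
              ((D𝒞.baseChange (pullback.fst 𝓨.total.hom (specResidueField v))).baseChange (𝓨.geomReductionMap x'').left) =
          ((pol𝒜.baseChange (pullback.fst 𝓨.total.hom (specResidueField v))).baseChange (𝓨.geomReductionMap x).left).lam ≫
            ((D𝒜.baseChange (pullback.fst 𝓨.total.hom (specResidueField v))).baseChange (𝓨.geomReductionMap x).left).hat.mulN n) ∧
      -- (v′) `u` finite surjective with `Ker u = 𝒜_x[𝔞]` on all `T`-points ⇒ `Ker ū = 𝒜_{x̄}[𝔞]` on ALL `T`-points
      (IsFinite u.left → Surjective u.left → ∀ ⦃T : Over (Spec (.of (geomResidueField v)))⦄ (t : T ⟶ ((𝒜.baseChange (pullback.fst 𝓨.total.hom (specResidueField v))).baseChange (𝓨.geomReductionMap x).left).X),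
        t ≫ ubar = 1 ↔ ∀ a ∈ 𝔞, t ≫ ((act.baseChange (pullback.fst 𝓨.total.hom (specResidueField v))).baseChange (𝓨.geomReductionMap x).left).i a = 1) := by
  obtain ⟨ubar, hmon, hi, hii, hiii, hiv, hv⟩ := exists_specialFibre_hom_reduction_ker 𝓨 𝒜 𝒞 x x'' u act E' hE' P Q hN hP hQ hQP hPQ h𝔞 hker
  haveI := hmon
  refine ⟨ubar, hmon, hi, hii, fun a h => ?_, hiii, hiv, hv⟩
  -- (ii-ι) = (ii) at `(act.i a, act″.i a)`; `((act.baseChange g).baseChange y).i a` unfolds to `baseChangeHom (baseChangeHom (act.i a) g) y` (★ `RingAction.baseChange_i`)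
  haveI := act.isMonHom a
  haveI := act''.isMonHom a
  have h' : baseChangeHom (baseChangeHom (act.i a) _) x.left ≫ u = u ≫ baseChangeHom (baseChangeHom (act''.i a) _) x''.left := by
    simpa only [RingAction.baseChange_i] using h
  simpa only [RingAction.baseChange_i] using hii (act.i a) (act''.i a) h'

end HeadKAction

end AbelianSchemeOver

end Literature.AlgebraicGeometry.AbelianSchemes

end
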